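import Summits.QuantumFields.YangMills.Theorems.BalabanUVNodesN07SchemeTokOfRecordTwoSmall
import Summits.QuantumFields.YangMills.Theorems.BalabanUVNodesK0AxSchemeOfRecordLetters
import Summits.QuantumFields.YangMills.Theorems.BalabanUVNodesN07ChartLineFactsS1
import HarnessLib

/-!
# NODE N07 → K0ᴬ — THE EVENTUAL LIE TOKEN ALONG THE UNIT FIELDS AT THE FLAT SCHEME OF RECORD, `N = 2`: the displayed hypothesis
# `htok : ∀ᶠ B in 𝓝 0, S.LieTokAt (unitField B)` of the (R-a) road ✓`…K0AxTangentSocketOnto.rootedReceipts_of_tokens_atScale_recordScheme` (`S = bgSchemeOfRecord F 2 K (k+1) Ω 1 …`)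
# SUPPLIED from Prop. 6's `RegimeTok`, the domain letter `dom ∈ 𝓝 1`, the chart letter `exp ρ₈ ⊆ SU(2)` and the displayed Sect. C ∕ data rows of ✓p825526 — the guard at `U₀ = 1` is free
# (✓`smallBelow_one`) and the (20)-smallness `‖W_B(c) − 1‖ ≤ 1/4` holds for `B` near `0` by continuity ([15] Prop. 6 p. 295, (15) p. 280, (20) p. 281; [I] p. 264)

Cell `pub-ymgap`, width seat `pub-ymgap-dag-n07-w3` (g27), CLAIM-9.  `--kind proof --supports stmt-QuantumFields-27238 --as helper`; count-neutral.
[15] = [Balaban1985Variational]; [I] = [Balaban1987RG1]; [B9] = [Balaban1985BackgroundPropagators].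

CONTENTS (`S := bgSchemeOfRecord F 2 K (k+1) Ω 1 dom levB G′ Δ2 a hposπ hpos♭ hQ ε_C B₀ C₄ a₃ j a𝔄 ε₄`, `W_B := unitField F θ k K B`).
* §1 `eventually_unitField_small` — `∀ᶠ B in 𝓝 0, ∀ c, ‖W_B(c)·Ū^{k+1}(1)(c)⋆ − 1‖ ≤ 1/4` (chart letter; `Ū^{k+1}(1) = 1`, `W_0 = 1`).
* §2 ★★★ `eventually_lieTokAt_unitField_ofRecord_two` — `RegimeTok` + `dom ∈ 𝓝 1` + chart letter + data rows (`G′`, `Δ2` real ∧ `S`-commuting) + Sect. C rows (`Regime H♭ 0 C^{𝔰𝔩} …`, `Prop4Hyp`,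
  `hCreal`, `hCtr`, `a₃ ≤ a_C`) ⟹ `∀ᶠ B in 𝓝 0, S.LieTokAt (W_B)`; ★★★ `…_of_tok` (the `Δ2` rows from `Delta2Tok ∧ Delta2SymmTok`, ✓p825642 ∕ ✓p821931).

HONEST LABELS.  Assembly; Prop. 6's `RegimeTok`, Sect. C's regime ∕ `Prop4Hyp` ∕ `hCreal` ∕ `hCtr` and the `G′` row stay DISPLAYED (Bałaban's estimates); `N = 2`; the K0 road's other displayed letters
(KNIT tokens, `WAnalyticTok`, (J-crit′)∕(J-cons′)) are untouched.  Count-neutral; N07 NOT discharged; K0ᴬ NOT closed; P0 ⟨26900⟩ OPEN; R4 is the conditional finite-𝕋⁴ rung only.  Nothing here is a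
claim about the Yang–Mills mass gap (`Summit.QuantumFields`): finite torus, fixed `ε`; nothing continuum ∕ OS ∕ Clay.
-/

set_option autoImplicit false

noncomputable section

open Filter Topology
open scoped Matrix Matrix.Norms.L2Operator InnerProductSpace ComplexConjugate

namespace Summit.QuantumFields.YangMills.Theorems.N07LieTokAtUnitFieldTwo

open Literature.MathematicalPhysics.QuantumFieldTheory.Balaban1983to89
open Literature.MathematicalPhysics.QuantumFieldTheory.Balaban1983to89.T4Continuum (T4Family)
open Literature.MathematicalPhysics.QuantumFieldTheory.Balaban1983to89.Node00
open T4Continuum BlockAveraging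
open B9Eq311TracePairing (starW)
open B9Eq3119DeltaPiReality (realConj_eq_self_iff)
open B11Eq103H1Complex (BondL2K SiteL2K)
open B11Eq111FrakG (nabla115)
open B11Eq115Space (NegSize NegSup levWeight JetSup)
open B11Eq174Chart (Regime)
open B11Prop6Scheme (Prop4Hyp)
open NormedSpace (exp)
open Summit.QuantumFields.YangMills.Theorems.K0RecordFormatNames
open Summit.QuantumFields.YangMills.Theorems.BalabanUVNodesPortS1 (unitField_zero)
open Summit.QuantumFields.YangMills.Theorems.K0AxCtabUniq (eventually_unitField_mem continuous_unitField_of_exp_mem)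
open Summit.QuantumFields.YangMills.Theorems.N07TraceSectorDefs (scalPartW)
open Summit.QuantumFields.YangMills.Theorems.N07LieTokAtOfRecordTwo (lieTokAt_bgSchemeOfRecord_two)
open Summit.QuantumFields.YangMills.Theorems.N07QuadPartReality (realConj_delta2_eq_self)
open Summit.QuantumFields.YangMills.Theorems.N07Delta2OfRecordTraceSectors (scalPartW_comm_delta2_of_tok)

variable (F : T4Family) (θ : Stage13Params F 2)

/-! ## §1  The (20)-smallness along the unit fields -/

/-- **`‖W_B(c)·Ū^{k+1}(1)(c)⋆ − 1‖ ≤ 1/4` FOR `B` NEAR `0`** (`Ū^{k+1}(1) = 1` ✓`avOfRecord_iter_one`, `W_0 = 1` ✓`unitField_zero`, `B ↦ W_B` continuous under the chart letter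
✓`continuous_unitField_of_exp_mem`; finitely many bonds). [cite: Balaban1985Variational, (20) p.281, (7) p.279; Balaban1987RG1, p.264] -/
theorem eventually_unitField_small (k K : ℕ)
    (hρ : letI := θ.instVβ₁; letI := θ.instVβ₂; ∀ v : θ.Vβ, exp (θ.ρ8 v) ∈ Matrix.specialUnitaryGroup (Fin 2) ℂ) :
    letI := θ.instVβ₁; letI := θ.instVβ₂
    ∀ᶠ B in 𝓝 (0 : Fin (F.P K).d → Site (F.P K) (k + 1) → θ.Vβ), ∀ c : PBond (F.P K) (k + 1),
      ‖((unitField F θ k K B c : SU 2) : Matrix (Fin 2) (Fin 2) ℂ) *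
          star ((Averaging.iter (avOfRecord F 2 K) (k + 1) (1 : GaugeField (F.P K) 0 (SU 2)) c : SU 2) : Matrix (Fin 2) (Fin 2) ℂ) - 1‖ ≤ 1 / 4 := by
  letI := θ.instVβ₁; letI := θ.instVβ₂
  rw [avOfRecord_iter_one]
  refine eventually_all.2 fun c => ?_
  have hcont : Continuous fun B : Fin (F.P K).d → Site (F.P K) (k + 1) → θ.Vβ =>
      ‖((unitField F θ k K B c : SU 2) : Matrix (Fin 2) (Fin 2) ℂ) * star (((1 : GaugeField (F.P K) (k + 1) (SU 2)) c : SU 2) : Matrix (Fin 2) (Fin 2) ℂ) - 1‖ :=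
    ((((continuous_subtype_val.comp ((continuous_apply c).comp (continuous_unitField_of_exp_mem F θ k K hρ))).mul continuous_const).sub
      continuous_const)).norm
  have h0 : ‖((unitField F θ k K (0 : Fin (F.P K).d → Site (F.P K) (k + 1) → θ.Vβ) c : SU 2) : Matrix (Fin 2) (Fin 2) ℂ) *
      star (((1 : GaugeField (F.P K) (k + 1) (SU 2)) c : SU 2) : Matrix (Fin 2) (Fin 2) ℂ) - 1‖ < 1 / 4 := by
    rw [unitField_zero F θ k K, show (1 : GaugeField (F.P K) (k + 1) (SU 2)) c = 1 from rfl, OneMemClass.coe_one, star_one, mul_one, sub_self, norm_zero]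
    norm_num
  exact ((hcont.tendsto 0).eventually (Iio_mem_nhds h0)).mono fun B hB => hB.le

/-! ## §2  The eventual Lie token along the unit fields -/

section Record

variable (k K : ℕ) [Fact (0 < (F.L : ℝ))] [Fact (0 < (F.P K).eta (k + 1))] [Fact (0 < c0Rec F K (k + 1))] [Fact (∀ c, 0 < wBRec F K (k + 1) c)]
  (Ω : ℕ → Set (Site (F.P K) 0)) (dom : Set (GaugeField (F.P K) (k + 1) (SU 2))) (levB : PBond (F.P K) (k + 1) → ℕ)
  {Gp : SiteL2K ℂ (F.P K).d (fun _ => (F.P K).sitesPerDir 0) (c0Rec F K (k + 1)) (WRec 2) →ₗ[ℂ]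
    SiteL2K ℂ (F.P K).d (fun _ => (F.P K).sitesPerDir 0) (c0Rec F K (k + 1)) (WRec 2)}
  {Δ2 : BondL2K ℂ (F.P K).d (fun _ => (F.P K).sitesPerDir 0) (c0Rec F K (k + 1)) (WRec 2) →ₗ[ℂ]
    BondL2K ℂ (F.P K).d (fun _ => (F.P K).sitesPerDir 0) (c0Rec F K (k + 1)) (WRec 2)} (a : ℝ)
  (hposπ : ∀ x, x ≠ 0 → 0 < RCLike.re ⟪x, laplaceAOfRecordAt F 2 (k + 1) (1 : GaugeField (F.P K) 0 (SU 2))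
    (hessOpOfRecord128 F 2 (k + 1) (1 : GaugeField (F.P K) 0 (SU 2)) Gp (QflatOfRecord F 2 (k + 1)) Δ2)
    (QOfRecord F 2 (k + 1) (1 : GaugeField (F.P K) 0 (SU 2))) (QflatOfRecord F 2 (k + 1)) a x⟫_ℂ)
  (hposb : ∀ x, x ≠ 0 → 0 < RCLike.re ⟪x, laplaceAOfRecord F 2 (k + 1) (1 : GaugeField (F.P K) 0 (SU 2))
    (QOfRecord F 2 (k + 1) (1 : GaugeField (F.P K) 0 (SU 2))) (QflatOfRecord F 2 (k + 1)) a x⟫_ℂ)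
  (hQ : Function.Surjective (QOfRecord F 2 (k + 1) (1 : GaugeField (F.P K) 0 (SU 2)))) (εC B₀ C₄ a₃ j a𝔄 ε₄ : ℝ) {b C₂ c₄ aC : ℝ}
  (RC : Regime (H1OfRecordAtBgFlat F 2 K (k + 1) Ω 1 levB a hposb hQ) 0 (CslOfRecord F 2 K (k + 1) Ω 1 levB) b 0 C₂ c₄ 0 aC εC)
  (hCreal : ∀ A : Space115Lit F 2 K (k + 1) Ω 1,
    ((JetSup.equiv _ _ (nabla115 ((F.P K).eta (k + 1)) (unitsOfRecord F 2 (1 : GaugeField (F.P K) 0 (SU 2))))).symm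
        (star (JetSup.equiv _ _ (nabla115 ((F.P K).eta (k + 1)) (unitsOfRecord F 2 (1 : GaugeField (F.P K) 0 (SU 2)))) A)) : Space115Lit F 2 K (k + 1) Ω 1) = A →
    ‖A‖ ≤ εC + aC → ((NegSup.equiv _ _).symm (star (NegSup.equiv _ _ (CslOfRecord F 2 K (k + 1) Ω 1 levB A))) :
      NegSize (F.L : ℝ) ((F.P K).eta (k + 1)) levB 0 (Matrix (Fin 2) (Fin 2) ℂ)) = CslOfRecord F 2 K (k + 1) Ω 1 levB A)
  (hCtr : ∀ A : Space115Lit F 2 K (k + 1) Ω 1,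
    ((JetSup.equiv _ _ (nabla115 ((F.P K).eta (k + 1)) (unitsOfRecord F 2 (1 : GaugeField (F.P K) 0 (SU 2))))).symm
        (star (JetSup.equiv _ _ (nabla115 ((F.P K).eta (k + 1)) (unitsOfRecord F 2 (1 : GaugeField (F.P K) 0 (SU 2)))) A)) : Space115Lit F 2 K (k + 1) Ω 1) = A →
    (∀ b', (JetSup.equiv _ _ (nabla115 ((F.P K).eta (k + 1)) (unitsOfRecord F 2 (1 : GaugeField (F.P K) 0 (SU 2)))) A b').trace = 0) →
    ‖A‖ ≤ εC + aC → ∀ c, (NegSup.equiv _ _ (CslOfRecord F 2 K (k + 1) Ω 1 levB A) c).trace = 0)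

include RC hCreal hCtr in
set_option maxHeartbeats 1600000 in
/-- ★★★ **THE EVENTUAL LIE TOKEN ALONG THE UNIT FIELDS** — the `htok` of ✓`rootedReceipts_of_tokens_atScale_recordScheme`: at the flat scheme of record (`U₀ = 1`, `N = 2`), Prop. 6's `RegimeTok`,
the domain letter `dom ∈ 𝓝 1`, the chart letter `exp ρ₈ ⊆ SU(2)`, the data rows (`G′`, `Δ2` real and `S`-commuting) and the displayed Sect. C rows give `S.LieTokAt (W_B)` for every `B` near `0`
(✓p825526 at each such `B`; the guard at `1` is ✓`smallBelow_one`). [cite: Balaban1985Variational, Prop. 6 p.295, (15) p.280, (20) p.281, (7) p.279; Balaban1987RG1, p.264] -/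
theorem eventually_lieTokAt_unitField_ofRecord_two
    (hGpR : ∀ s, Gp (starW (phiRec 2) s) = starW (phiRec 2) (Gp s)) (hGpS : ∀ s, Gp (scalPartW 2 _ s) = scalPartW 2 _ (Gp s))
    (hΔ2R : ∀ x, Δ2 (starW (phiRec 2) x) = starW (phiRec 2) (Δ2 x)) (hΔ2S : ∀ x, Δ2 (scalPartW 2 _ x) = scalPartW 2 _ (Δ2 x))
    (hP : Prop4Hyp (CslOfRecord F 2 K (k + 1) Ω 1 levB) C₂ c₄) (haC : a₃ ≤ aC)
    (hT : (bgSchemeOfRecord F 2 K (k + 1) Ω 1 dom levB Gp Δ2 a hposπ hposb hQ εC B₀ C₄ a₃ j a𝔄 ε₄).RegimeTok)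
    (hd : dom ∈ 𝓝 (1 : GaugeField (F.P K) (k + 1) (SU 2)))
    (hρ : letI := θ.instVβ₁; letI := θ.instVβ₂; ∀ v : θ.Vβ, exp (θ.ρ8 v) ∈ Matrix.specialUnitaryGroup (Fin 2) ℂ) :
    letI := θ.instVβ₁; letI := θ.instVβ₂
    ∀ᶠ B in 𝓝 (0 : Fin (F.P K).d → Site (F.P K) (k + 1) → θ.Vβ),
      (bgSchemeOfRecord F 2 K (k + 1) Ω 1 dom levB Gp Δ2 a hposπ hposb hQ εC B₀ C₄ a₃ j a𝔄 ε₄).LieTokAt (unitField F θ k K B) := by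
  letI := θ.instVβ₁; letI := θ.instVβ₂
  have hguard : SmallBelow (avOfRecord F 2 K) (k + 1) (1 : GaugeField (F.P K) 0 (SU 2)) := Summit.QuantumFields.YangMills.BalabanUVNodes.N07ChartLineFactsS1.smallBelow_one F K (k + 1)
  filter_upwards [eventually_unitField_mem F θ k K hρ hd, eventually_unitField_small F θ k K hρ] with B hB hsB
  exact lieTokAt_bgSchemeOfRecord_two F K (k + 1) Ω 1 dom levB a hposπ hposb hQ εC B₀ C₄ a₃ j a𝔄 ε₄ RC hCreal hCtr hguard hGpR hGpS hΔ2R hΔ2S hP haC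
    (hT _ hB).1 (hT _ hB).2.1 (hT _ hB).2.2 hsB

include RC hCreal hCtr in
set_option maxHeartbeats 1600000 in
/-- ★★★ **THE SAME WITH THE `Δ2` ROWS FROM THE TOKENS** (`Delta2Tok ∧ Delta2SymmTok`: `Δ2` real ✓p821931, `S`-commuting ✓p825642). [cite: Balaban1985Variational, Prop. 6 p.295; Balaban1985BackgroundPropagators, (3.134) p.422] -/
theorem eventually_lieTokAt_unitField_ofRecord_two_of_tok
    (hGpR : ∀ s, Gp (starW (phiRec 2) s) = starW (phiRec 2) (Gp s)) (hGpS : ∀ s, Gp (scalPartW 2 _ s) = scalPartW 2 _ (Gp s))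
    (hΔ : Delta2Tok F 2 K (k + 1) Ω 1 levB a hposb hQ Δ2) (hs : Delta2SymmTok F 2 K (k + 1) Ω 1 Δ2)
    (hP : Prop4Hyp (CslOfRecord F 2 K (k + 1) Ω 1 levB) C₂ c₄) (haC : a₃ ≤ aC)
    (hT : (bgSchemeOfRecord F 2 K (k + 1) Ω 1 dom levB Gp Δ2 a hposπ hposb hQ εC B₀ C₄ a₃ j a𝔄 ε₄).RegimeTok)
    (hd : dom ∈ 𝓝 (1 : GaugeField (F.P K) (k + 1) (SU 2)))
    (hρ : letI := θ.instVβ₁; letI := θ.instVβ₂; ∀ v : θ.Vβ, exp (θ.ρ8 v) ∈ Matrix.specialUnitaryGroup (Fin 2) ℂ) :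
    letI := θ.instVβ₁; letI := θ.instVβ₂
    ∀ᶠ B in 𝓝 (0 : Fin (F.P K).d → Site (F.P K) (k + 1) → θ.Vβ),
      (bgSchemeOfRecord F 2 K (k + 1) Ω 1 dom levB Gp Δ2 a hposπ hposb hQ εC B₀ C₄ a₃ j a𝔄 ε₄).LieTokAt (unitField F θ k K B) := by
  have hguard : SmallBelow (avOfRecord F 2 K) (k + 1) (1 : GaugeField (F.P K) 0 (SU 2)) := Summit.QuantumFields.YangMills.BalabanUVNodes.N07ChartLineFactsS1.smallBelow_one F K (k + 1)
  have hΔ2R : ∀ x, Δ2 (starW (phiRec 2) x) = starW (phiRec 2) (Δ2 x) :=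
    (realConj_eq_self_iff (phiRec 2) Δ2).1 (realConj_delta2_eq_self F 2 K (k + 1) Ω 1 levB a hposb hQ hguard hΔ hs)
  have hΔ2S : ∀ x, Δ2 (scalPartW 2 _ x) = scalPartW 2 _ (Δ2 x) := scalPartW_comm_delta2_of_tok F 2 K (k + 1) Ω 1 levB a hposb hQ hΔ hs
  exact eventually_lieTokAt_unitField_ofRecord_two F θ k K Ω dom levB a hposπ hposb hQ εC B₀ C₄ a₃ j a𝔄 ε₄ RC hCreal hCtr hGpR hGpS hΔ2R hΔ2S hP haC hT hd hρ

end Record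

end Summit.QuantumFields.YangMills.Theorems.N07LieTokAtUnitFieldTwo

end
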